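import Summits.Ventures.PercRepro.RankLevelSetDepCountSplit
import Summits.Ventures.PercRepro.RankLevelSetLevelSevenArithCapTH
import Summits.Ventures.PercRepro.RankLevelSetExplicitSeven
import Summits.Ventures.PercRepro.S1TriangleCount
import Summits.Ventures.PercRepro.RankLevelSetTriangleStar
import Summits.Ventures.PercRepro.RankLevelSetCorankFiveCounts
import Summits.Ventures.PercRepro.RankLevelSetCoreFour
import Summits.Ventures.PercRepro.RankLevelSetFrameLarge
import Summits.Ventures.PercRepro.RankLevelSetFrameQM
import Summits.Ventures.PercRepro.RankLevelSetLevelSplitAll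

/-!
# PercRepro — THEOREM C₇, SPLIT COUNT WITH THE NULLITY CAP AND LEMMA T: C-025 AT LEVEL `7` FOR EVERY FINITE MATROID
AND EVERY `p ≥ 1789` (p9, S4)

`proofs/SUBCLAIM-S4-p9.md` §S4.1 (c). The level-`7` recipe of night-1 (their `RankLevelSetLevelSeven`, a seat record:
`f(7) ≤ 87`, the core beyond corank `95` from `core_all_corank_of_thresholds_of_bound 7 87` with the regime thresholds
`136` / `111`, the `88` polynomial inequalities at coranks `8 … 95`) with the two changes p8 made at level `6`
(`RankLevelSetLevelSixCapT`): the NULLITY CAP — a rank-`k` set of a matroid of nullity `d` has at most `k + d` points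
(`encard_le_eRk_add_of_encard_eq`), so night-1's split lemma `ncard_eRk_eq_ncard_le_le_split` is applied with
`f = min 87 (7 + d)`, `f′ = min 43 (6 + d)` (the fibre of a pair `(C, B′)` has at most `min(79, d − 1)` free points in the
big class and `min(36, d − 1)` in the small class) — and p2's LEMMA T (`S1.two_mul_ncard_triangles_le`: `2·s₃ ≤ d(d + 1)`)
in place of `s₃ ≤ d²`. The polynomial inequalities `level_seven_poly_capT` (`RankLevelSetLevelSevenArithCapTA … H`) then
hold from `p ≥ 1788` (binding corank `d = 37`; `1787` fails there) instead of night-1's `669 843 649` (plain count) /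
`77 040` (split count, seat record) and this seat's `1 506 590 260` (`RankLevelSetExplicitSeven`, the general-`q` recipe).

* `c025_core_seven_beyond_ninetyfive` — the `e`-free core at level `7`, corank `≥ 96`, rank `p ≥ 136`;
* `c025_core_seven_bounded_corank_capT` — the `e`-free core at level `7`, corank `8 ≤ d ≤ 95`, rank `p ≥ 1788`;
* `c025_seven_of_six_capT` — level `6` for all `p ≥ 1788` ⇒ level `7` for all `p ≥ 1789`;
* `c025_seven_large_capT'` — UNCONDITIONAL over the tree: every finite matroid satisfies C-025 at level `7` for every
  `p ≥ 1789` (`hprev` = night-1's split row `c025_six_large_split`, level `6` for `p ≥ 1225`).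
Axioms: standard.
-/

open scoped Matroid

namespace PercRepro

namespace ThmN

open Set

variable {α : Type}

namespace Explicit

/-- `Σ_{k ∈ [3, 8]} g k = g 3 + g 4 + g 5 + g 6 + g 7 + g 8` (night-1's `sum_Icc_three_eight`, re-proved here). -/
theorem sum_Icc_three_eight (g : ℕ → ℕ) :
    ∑ k ∈ Finset.Icc 3 8, g k = g 3 + g 4 + g 5 + g 6 + g 7 + g 8 := by
  rw [show (8 : ℕ) = 7 + 1 from rfl, Finset.sum_Icc_succ_top (by norm_num),
    show (7 : ℕ) = 6 + 1 from rfl, Finset.sum_Icc_succ_top (by norm_num),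
    show (6 : ℕ) = 5 + 1 from rfl, Finset.sum_Icc_succ_top (by norm_num),
    show (5 : ℕ) = 4 + 1 from rfl, Finset.sum_Icc_succ_top (by norm_num),
    show (4 : ℕ) = 3 + 1 from rfl, Finset.sum_Icc_succ_top (by norm_num), Finset.Icc_self,
    Finset.sum_singleton]

end Explicit

/-- **The `e`-free core at level `7` beyond corank `95`**: rank `p ≥ 136`, `|E| > p + 95` ⇒ C-025 at `(p, 7)`
(`core_all_corank_of_thresholds_of_bound 7 87` with the flat bound `f(7) ≤ 87` and the regime thresholds `N₁ = 136`,
`P₂ = 111`; night-1's `c025_core_seven_eightyseven`, re-proved on the landed `f(7) ≤ 87`). -/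
theorem c025_core_seven_beyond_ninetyfive (M : Matroid α) [M.Finite] (p : ℕ) (hp : 136 ≤ p)
    (hR : M.eRank = (p : ℕ∞)) (hbig : p + 95 < M.E.ncard)
    (hfree : ∀ e ∈ M.E, ∃ A ⊆ M.E \ {e}, e ∉ M.closure A ∧ e ∉ M.closure ((M.E \ {e}) \ A)) : RLS M p 7 := by
  have hN₁ : ∀ n, 136 ≤ n → 8 * (7 + 1) * 2 ^ (87 - 7) * n ^ 7 ≤ 2 ^ n :=
    mul_pow_le_two_pow_of_base (8 * (7 + 1) * 2 ^ (87 - 7)) 7 136 (by norm_num) (by norm_num) (by norm_num)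
  have hP₂ := threshold_II_of_base 7 (2 ^ (87 - 7)) 111 (by norm_num) (by norm_num)
  have hmax : max (max 136 111) (2 ^ 7 + 2) = 136 := by decide
  have hBj : ∀ j : ℕ, j ≤ 7 → ∀ X ⊆ M.E, M.eRk X ≤ j → X.ncard + 7 ≤ 87 + j := by
    intro j hj X hX hr
    rcases Nat.lt_or_ge j 7 with h | h
    · have := ncard_add_one_le_two_pow_of_eRk_le M (not_isLoop_of_free M hfree) hfree j X hX hr
      interval_cases j <;> omega
    · have hj7 : j = 7 := by omega
      subst hj7
      have := Explicit.ncard_le_eightyseven_of_free M hfree X hX hr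
      omega
  exact core_all_corank_of_thresholds_of_bound 7 87 (by norm_num) (by norm_num) 136 111 hN₁ hP₂ M p
    (by rw [hmax]; exact hp) hR (by omega) hfree hBj

/-- **The `e`-free core at level `7`, corank `8 ≤ d ≤ 95`, rank `p ≥ 1788`** (split count, nullity cap, Lemma T). -/
theorem c025_core_seven_bounded_corank_capT (M : Matroid α) [M.Finite] (p d : ℕ) (hp : 1788 ≤ p) (hd8 : 8 ≤ d)
    (hd95 : d ≤ 95) (hR : M.eRank = (p : ℕ∞)) (hn : M.E.ncard = p + d)
    (hfree : ∀ e ∈ M.E, ∃ A ⊆ M.E \ {e}, e ∉ M.closure A ∧ e ∉ M.closure ((M.E \ {e}) \ A)) :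
    RLS M p 7 := by
  classical
  have hEcard : M.ground_finite.toFinset.card = p + d := by
    rw [← Set.ncard_eq_toFinset_card _ M.ground_finite]; exact hn
  -- the core is simple: every circuit has `≥ 3` elements
  have hL : ∀ e ∈ M.E, ¬ M.IsLoop e := not_isLoop_of_free M hfree
  have hs : ∀ e ∈ M.E, ∀ f ∈ M.E, e ≠ f → M.eRk {e, f} = 2 := by
    intro e he f hf hef
    have h2 : (2 : ℕ∞) ≤ M.eRk {e, f} :=
      two_le_eRk_of_two_le_ncard_of_free M hfree (pair_subset he hf) (by rw [ncard_pair hef])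
    have h3 : M.eRk {e, f} ≤ 2 := by
      have := M.eRk_le_encard {e, f}
      rwa [encard_pair hef] at this
    exact le_antisymm h3 h2
  have hcirc : ∀ C, M.IsCircuit C → 3 ≤ C.encard := three_le_encard_of_circuit M hL hs
  have hd : M.E.encard = M.eRank + d := by
    rw [hR, ← M.ground_finite.cast_ncard_eq, hn]
    push_cast
    ring
  -- the nullity cap: every `X ⊆ E` has `|X| ≤ r(X) + d`
  have hcap : ∀ X ⊆ M.E, ∀ k : ℕ, M.eRk X ≤ k → X.ncard ≤ k + d := by
    intro X hX k hr
    have h1 := Matroid.encard_le_eRk_add_of_encard_eq hX hd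
    have h2 : X.encard ≤ (k : ℕ∞) + d := h1.trans (by gcongr)
    have hfin : X.Finite := M.ground_finite.subset hX
    rw [← hfin.cast_ncard_eq] at h2
    exact_mod_cast h2
  -- rank-`≤ 7` sets have `≤ min 87 (7 + d)` points, rank-`≤ 6` sets `≤ min 43 (6 + d)`
  have hflat : ∀ X ⊆ M.E, M.eRk X ≤ 7 → X.ncard ≤ min 87 (7 + d) :=
    fun X hX hr => le_min (Explicit.ncard_le_eightyseven_of_free M hfree X hX hr) (hcap X hX 7 hr)
  have hflat' : ∀ X ⊆ M.E, M.eRk X ≤ ((7 - 1 : ℕ) : ℕ∞) → X.ncard ≤ min 43 (6 + d) :=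
    fun X hX hr => le_min (ncard_le_fortythree_of_eRk_le_six_of_free M hfree hX (by simpa using hr))
      (hcap X hX 6 (by simpa using hr))
  -- (U)
  have hU1 := Matroid.topCount_le_ncard_compl (M := M) hR hd 7
  have hU2 := Matroid.ncard_eRk_eq_ncard_le_le_split M 7 (min 87 (7 + d)) (min 43 (6 + d)) (by norm_num)
    hcirc hflat hflat' hd
  rw [hn, Explicit.sum_Icc_three_eight, Explicit.sum_Icc_three_eight] at hU2
  simp only [show (7 : ℕ) + 1 - 3 = 5 from rfl, show (7 : ℕ) + 1 - 4 = 4 from rfl,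
    show (7 : ℕ) + 1 - 5 = 3 from rfl, show (7 : ℕ) + 1 - 6 = 2 from rfl,
    show (7 : ℕ) + 1 - 7 = 1 from rfl, show (7 : ℕ) + 1 - 8 = 0 from rfl, Nat.choose_one_right,
    Nat.choose_zero_right, mul_one, show (7 : ℕ) + 1 = 8 from rfl] at hU2
  have hC1 : ∀ L ⊆ M.E, M.eRk L = 2 → L.ncard ≤ 3 :=
    fun L hL hr => ncard_le_three_of_eRk_two M hs hfree hL hr
  have hs3 : {C | M.IsCircuit C ∧ C.ncard = 3}.ncard ≤ d * (d + 1) / 2 := by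
    have hT : 2 * {C | M.IsCircuit C ∧ C.ncard = 3}.ncard ≤ d * (d + 1) := S1.two_mul_ncard_triangles_le M hC1 hd
    omega
  have hs4 : {C | M.IsCircuit C ∧ C.ncard = 4}.ncard ≤ (d + 3).choose 4 :=
    Matroid.ncard_circuits_le_choose_of_encard M hd 3
  have hs5 : {C | M.IsCircuit C ∧ C.ncard = 5}.ncard ≤ (d + 4).choose 5 :=
    Matroid.ncard_circuits_le_choose_of_encard M hd 4
  have hs6 : {C | M.IsCircuit C ∧ C.ncard = 6}.ncard ≤ (d + 5).choose 6 :=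
    Matroid.ncard_circuits_le_choose_of_encard M hd 5
  have hs7 : {C | M.IsCircuit C ∧ C.ncard = 7}.ncard ≤ (d + 6).choose 7 :=
    Matroid.ncard_circuits_le_choose_of_encard M hd 6
  have hs8 : {C | M.IsCircuit C ∧ C.ncard = 8}.ncard ≤ (d + 7).choose 8 :=
    Matroid.ncard_circuits_le_choose_of_encard M hd 7
  have hU : Matroid.topCount M p 7 ≤ (p + d).choose 7 +
      (∑ j ∈ Finset.range (d - 8 + 1), Nat.choose (min 43 (6 + d) - 7) j) *
        ((d * (d + 1) / 2) * (p + d).choose 5 + (d + 3).choose 4 * (p + d).choose 4 +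
          (d + 4).choose 5 * (p + d).choose 3 + (d + 5).choose 6 * (p + d).choose 2 +
          (d + 6).choose 7 * (p + d) + (d + 7).choose 8) +
      (∑ j ∈ Finset.range (d - 8 + 1), Nat.choose (min 87 (7 + d) - 8) j) *
        ((d * (d + 1) / 2) * (8 * d).choose 5 + (d + 3).choose 4 * (8 * d).choose 4 +
          (d + 4).choose 5 * (8 * d).choose 3 + (d + 5).choose 6 * (8 * d).choose 2 +
          (d + 6).choose 7 * (8 * d) + (d + 7).choose 8) := by
    refine hU1.trans (hU2.trans ?_)
    gcongr
  -- (Y)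
  have hY := Matroid.two_pow_le_midCount_add (M := M) p 7 hR
  have hA : {X : Set α | X ⊆ M.E ∧ M.eRk X ≤ 7}.ncard ≤ ∑ j ∈ Finset.range (87 + 1), (p + d).choose j := by
    calc {X : Set α | X ⊆ M.E ∧ M.eRk X ≤ 7}.ncard
        ≤ {X : Set α | X ⊆ (M.ground_finite.toFinset : Set α) ∧ X.ncard ≤ 87}.ncard := by
          apply ncard_le_ncard
          · intro X hX
            exact ⟨by rw [Set.Finite.coe_toFinset]; exact hX.1, (hflat X hX.1 hX.2).trans (min_le_left _ _)⟩
          · exact (Finset.finite_toSet _).finite_subsets.subset (fun X hX => hX.1)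
      _ ≤ ∑ j ∈ Finset.range (87 + 1), M.ground_finite.toFinset.card.choose j :=
          ncard_subsets_ncard_le _ 87
      _ = ∑ j ∈ Finset.range (87 + 1), (p + d).choose j := by rw [hEcard]
  have hB := Matroid.ncard_spanning_le (M := M) hd
  rw [hEcard] at hY hB
  -- the tails: `16·Σ_{j ≤ 95} C(n, j) ≤ 2^n` for `n ≥ 290`
  have hT : 16 * ∑ j ∈ Finset.range (95 + 1), (p + d).choose j ≤ 2 ^ (p + d) :=
    Explicit.sixteen_mul_sum_range_choose_le 95 (p + d) (by omega)
  have hA' : ∑ j ∈ Finset.range (87 + 1), (p + d).choose j ≤ ∑ j ∈ Finset.range (95 + 1), (p + d).choose j :=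
    Finset.sum_le_sum_of_subset_of_nonneg (Finset.range_mono (by norm_num)) (fun _ _ _ => Nat.zero_le _)
  have hB' : ∑ j ∈ Finset.range (d + 1), (p + d).choose j ≤ ∑ j ∈ Finset.range (95 + 1), (p + d).choose j :=
    Finset.sum_le_sum_of_subset_of_nonneg (Finset.range_mono (by omega)) (fun _ _ _ => Nat.zero_le _)
  have hAB : 8 * ({X : Set α | X ⊆ M.E ∧ M.eRk X ≤ 7}.ncard +
      {X : Set α | X ⊆ M.E ∧ M.eRk X = M.eRank}.ncard) ≤ 2 ^ (p + d) := by
    have h1 := hA.trans hA'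
    have h2 := hB.trans hB'
    omega
  -- (Φ) and the polynomial inequality
  have hΦ := phiK_le_two_pow_div p 7
  rw [Nat.choose_symm_add] at hΦ
  have hpoly := level_seven_poly_capT d hd8 hd95 p hp
  rw [add_assoc] at hU hpoly
  -- assemble in `ℚ`
  rw [RLS_iff]
  have hUq : (Matroid.topCount M p 7 : ℚ) ≤ ((p + d).choose 7 : ℚ) +
      (((∑ j ∈ Finset.range (d - 8 + 1), Nat.choose (min 43 (6 + d) - 7) j) *
        ((d * (d + 1) / 2) * (p + d).choose 5 + (d + 3).choose 4 * (p + d).choose 4 +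
          (d + 4).choose 5 * (p + d).choose 3 + (d + 5).choose 6 * (p + d).choose 2 +
          (d + 6).choose 7 * (p + d) + (d + 7).choose 8) +
      (∑ j ∈ Finset.range (d - 8 + 1), Nat.choose (min 87 (7 + d) - 8) j) *
        ((d * (d + 1) / 2) * (8 * d).choose 5 + (d + 3).choose 4 * (8 * d).choose 4 +
          (d + 4).choose 5 * (8 * d).choose 3 + (d + 5).choose 6 * (8 * d).choose 2 +
          (d + 6).choose 7 * (8 * d) + (d + 7).choose 8) : ℕ) : ℚ) := by
    exact_mod_cast hU
  have hYq : (2 : ℚ) ^ (p + d) ≤ (Matroid.midCount M p 7 : ℚ) +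
      ({X : Set α | X ⊆ M.E ∧ M.eRk X ≤ 7}.ncard : ℚ) +
      ({X : Set α | X ⊆ M.E ∧ M.eRk X = M.eRank}.ncard : ℚ) := by exact_mod_cast hY
  have hABq : 8 * (({X : Set α | X ⊆ M.E ∧ M.eRk X ≤ 7}.ncard : ℚ) +
      ({X : Set α | X ⊆ M.E ∧ M.eRk X = M.eRank}.ncard : ℚ)) ≤ 2 ^ (p + d) := by exact_mod_cast hAB
  have hpolyq : 8 * (((p + d).choose 7 : ℚ) +
      (((∑ j ∈ Finset.range (d - 8 + 1), Nat.choose (min 43 (6 + d) - 7) j) *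
        ((d * (d + 1) / 2) * (p + d).choose 5 + (d + 3).choose 4 * (p + d).choose 4 +
          (d + 4).choose 5 * (p + d).choose 3 + (d + 5).choose 6 * (p + d).choose 2 +
          (d + 6).choose 7 * (p + d) + (d + 7).choose 8) +
      (∑ j ∈ Finset.range (d - 8 + 1), Nat.choose (min 87 (7 + d) - 8) j) *
        ((d * (d + 1) / 2) * (8 * d).choose 5 + (d + 3).choose 4 * (8 * d).choose 4 +
          (d + 4).choose 5 * (8 * d).choose 3 + (d + 5).choose 6 * (8 * d).choose 2 +
          (d + 6).choose 7 * (8 * d) + (d + 7).choose 8) : ℕ) : ℚ)) ≤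
      7 * 2 ^ (d - 7) * ((p + 7).choose 7 : ℚ) := by exact_mod_cast hpoly
  have hU0 : (0 : ℚ) ≤ (Matroid.topCount M p 7 : ℚ) := Nat.cast_nonneg _
  have hd7 : 7 ≤ d := by omega
  exact level_arith (p := p) (d := d) (n := p + d) (q := 7) rfl hd7 hΦ hU0 hUq hYq hABq hpolyq

/-- **THEOREM C₇, SPLIT COUNT WITH THE NULLITY CAP AND LEMMA T, GIVEN LEVEL `6`**: level `6` for all `p ≥ 1788`
implies level `7` for all `p ≥ 1789`. -/
theorem c025_seven_of_six_capT (h6 : ∀ (M : Matroid α) [M.Finite] (p : ℕ), 1788 ≤ p → RLS M p 6) :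
    ∀ (M : Matroid α) [M.Finite] (p : ℕ), 1789 ≤ p → RLS M p 7 := by
  intro M _ p hp
  refine rls_succ_large (α := α) 6 7 1788 ?_ ?_ ?_ M p hp (by omega)
  · -- level `6` for `p ≥ 1788`
    intro M' _ p' hP _
    exact h6 M' p' (by omega)
  · -- corank `≤ 7`: `U = ∅` or Theorem M
    intro M' _ p' _ hn _
    rcases Nat.lt_or_ge M'.E.ncard (p' + 7) with h | h
    · exact RLS_of_ncard_lt M' h
    · exact RLS_of_ncard_eq M' (by omega)
  · -- the core: coranks `8 … 95` by counting, coranks `≥ 96` beyond the flat bound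
    intro M' _ p' hP hR hbig _ hfree
    rcases Nat.lt_or_ge M'.E.ncard (p' + 96) with h | h
    · exact c025_core_seven_bounded_corank_capT M' p' (M'.E.ncard - p') hP (by omega) (by omega) hR (by omega) hfree
    · exact c025_core_seven_beyond_ninetyfive M' p' (by omega) hR (by omega) hfree

/-- **THEOREM C₇ WITH THE NULLITY CAP AND LEMMA T, UNCONDITIONAL OVER THE TREE**: every finite matroid satisfies C-025
at level `7` for every `p ≥ 1789` — night-1's split row `c025_six_large_split` (level `6` for `p ≥ 1225`) through the
wrapper at `P = 1788` with the capped core theorem. -/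
theorem c025_seven_large_capT' (M : Matroid α) [M.Finite] (p : ℕ) (hp : 1789 ≤ p) : RLS M p 7 :=
  c025_seven_of_six_capT (fun M' _ p' hp' => c025_six_large_split M' p' (by omega)) M p hp

/-- The same in the literal `C025` body: `phiK p 7 · #U(p, 7) ≤ #Y(p, 7)` for every finite matroid and every `p ≥ 1789`. -/
theorem c025_seven_large_capT (M : Matroid α) [M.Finite] (p : ℕ) (hp : 1789 ≤ p) :
    phiK p 7 * ({A : Set α | A ⊆ M.E ∧ M.eRk A = (p : ℕ∞) ∧ M.eRk (M.E \ A) = (7 : ℕ∞)}.ncard : ℚ) ≤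
      ({A : Set α | A ⊆ M.E ∧ (7 : ℕ∞) < M.eRk A ∧ M.eRk A < (p : ℕ∞)}.ncard : ℚ) :=
  c025_seven_large_capT' M p hp

end ThmN

end PercRepro
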